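import Literature.AlgebraicGeometry.ComplexMultiplication.CyclotomicFermatCMTypesPrimePowerParityCriterion
import HarnessLib

/-!
# Koblitz–Rohrlich THEOREM 4 (`N = 2ⁿ`): the non-obvious coincidences `H_τ = H_{τ′}` for EVERY `n` — families e), d) and the
# "furthermore" (a)ₘ with two e)ₘ₊₁) — SECOND PROOFS, read off the parity criterion at `p = 2`
# (first proofs: `CyclotomicFermatCMTypesTwoPowerLevelCoincidences`, `…TwoPowerLevelFurthermore`, gen 36, by residue identities)

Layer `Literature/AlgebraicGeometry/ComplexMultiplication`, namespace `…ComplexMultiplication.CyclotomicFermatCMType`; sequel of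
`CyclotomicFermatCMTypesPrimePowerParityCriterion` (at `N = pⁿ`, ANY prime `p`: `H_{τ′} = H_τ` iff the parity condition
`μ_τ(x) + μ_{τ′}(−x) = μ_τ(−x) + μ_{τ′}(x)` on the units, `μ_τ(x) = #{a ∈ τ : p^{v(a)}x = a}`) and companion of
`CyclotomicFermatCMTypesTwoPowerLevelIsogenies` (Theorem 4's members at `N = 8, 16, 32` by kernel enumeration, complete lists at `8` and,
normalised, `16`).  THEOREMS ONLY (no definition, no named fact, no `sorry`, no kernel `decide`).

**DUPLICATION NOTICE (v3, docstrings only).**  The equalities of §§2–4 were ALREADY in the tree, by a different road (explicit residue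
identities), in the gen-36 files `CyclotomicFermatCMTypesTwoPowerLevelCoincidences` (`fermatCMType_twoPow_e_eq`, `n ≥ 2`;
`fermatCMType_twoPow_d_eq`, `n ≥ 4`; non-obviousness `not_exists_multiset_eq_twoPow_e/_d`), `CyclotomicFermatCMTypesTwoPowerLevelFurthermore`
(`fermatCMType_twoPow_furthermore_eq`, `fermatCMType_twoPow_furthermore_snd_eq`, `fermatCMType_twoPow_e_one_eq`) and
`CyclotomicFermatCMTypesTwoPowerLevelUniformLevel` (every admissible `m` at the printed level), which this seat overlooked when writing v1.
The statements here differ only in the spelling of the entries (`-1 + 2^(n-1)` for `((2^(n-1) - 1 : ℕ) : ZMod (2^n))`, `-2` for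
`((2^n - 2 : ℕ) : …)`, …) and in the proofs (parity criterion instead of residue identities); they are KEPT as second proofs exercising the
parity road at `p = 2` (the road a completeness proof of Theorem 4 would take), not as new content.  New in this file: §1's tools
(`factorization_val_pow_mul` etc.), §5 (the printed a)/c) partners are unit multiples for every `n`), and the numerical note below.

THE SOURCE.  N. Koblitz, D. Rohrlich, *Simple factors in the Jacobian of a Fermat curve*, Canad. J. Math. **30** (1978) 1183–1205,
THEOREM 4 (p. 1186): "Suppose `N = 2ⁿ`. Then the only isogenies apart from the obvious ones are between pairs of lattices corresponding
to the triples a) `(2ᵐ, 2ⁿ⁻¹ − 2ᵐ⁺¹, 2ⁿ⁻¹ + 2ᵐ)` and … , …, d) `(2ᵐ, 3(2ᵐ), 2ⁿ − 2ᵐ⁺²)` and `(2ⁿ⁻¹ − 2ᵐ, 2ⁿ⁻¹ − 2ᵐ⁺¹, 3(2ᵐ))` for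
`0 ≤ m ≤ n − 4`, or e) `(2ᵐ, 2ⁿ⁻¹, 2ⁿ⁻¹ − 2ᵐ)` and `(2ᵐ, 2ᵐ, 2ⁿ − 2ᵐ⁺¹)` for `0 ≤ m ≤ n − 2`.  Furthermore, a lattice of type a)ₘ is
isogenous to the product of two lattices of type e)ₘ₊₁."  (Our copy of p. 1186 is only partly legible for a)–c); the sibling
`…TwoPowerLevelIsogenies` records this.)

## What is proved (`N = 2ⁿ`, `n ≥ 3`, `N₁ = 2ⁿ⁻¹` written `(2 : ZMod (2 ^ n)) ^ (n - 1)`; the members with `m = 0`, i.e. g.c.d. `= 1`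
## — the `m ≥ 1` members are their pull-backs from level `2ⁿ⁻ᵐ`, sibling `CyclotomicFermatCMTypesLevelPullback`)

* §1 Tools at `p = 2` (some for any prime `p`): `factorization_val_pow_mul` (`v(pᵏ·u) = k` for a unit `u`, `k < n`),
  `pow_ne_zero_of_lt_twoPow`, `two_mul_eq_zero_iff_twoPow` (`2y = 0 ⟺ y ∈ {0, N₁}`), `two_mul_eq_two_mul_iff_twoPow`
  (`2x = 2c ⟺ x ∈ {c, c + N₁}`), `four_mul_eq_four_mul_iff_twoPow`, `pow_pred_mul_eq_of_isUnit_twoPow` (`N₁·x = N₁` for odd `x`),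
  `isUnit_of_castHom_two_ne_zero` (odd residues are units).
* §2 **family e), every `n ≥ 3`**: `H_{(1, N₁−1, N₁)} = H_{(1, 1, 2ⁿ−2)}` (`fermatCMType_twoPow_e`).
* §3 **family d), every `n ≥ 3`**: `H_{(3, N₁−2, N₁−1)} = H_{(1, 3, 2ⁿ−4)}` (`fermatCMType_twoPow_d`; K–R's `(2ⁿ⁻¹ − 1, 2ⁿ⁻¹ − 2, 3)`
  and `(1, 3, 2ⁿ − 4)` at `m = 0`).
* §4 **the "furthermore", every `n ≥ 3`**: `H_{(2, 2, 2ⁿ−4)} = H_{(1, N₁−2, N₁+1)}` and `H_{(2, N₁−2, N₁)} = H_{(1, N₁−2, N₁+1)}`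
  (`fermatCMType_twoPow_a_e₁`, `fermatCMType_twoPow_a_e₁'`): the a)₀ triple `(1, 2ⁿ⁻¹ − 2, 2ⁿ⁻¹ + 1)` has the residue set of the two
  (level-`2ⁿ⁻¹`-induced) e)₁ triples `(2, 2, 2ⁿ − 4)`, `(2, 2ⁿ⁻¹, 2ⁿ⁻¹ − 2)`.
* §5 (v2) the printed partners in a) and c), as legible in our copy, are UNIT MULTIPLES of the first triples (`u = 2ⁿ⁻² − 1`, resp.
  `u = 2ⁿ⁻¹ − 1`): `exists_unit_multiset_eq_twoPow_a`, `exists_unit_multiset_eq_twoPow_c` — "obvious" in the sense of p. 1185.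

Each equality is obtained from the parity criterion (`fermatCMType_eq_of_forall_countP`): the fibres of the even entries are written out
(`2x = −2 ⟺ x ∈ {−1, N₁ − 1}`, `4x = −4 ⟺ x ∈ {−1, N₁ − 1} ∨ 2(x + 1) = N₁`, `N₁x = N₁` for all odd `x`) and the two multiplicity
functions are seen to differ by an even function.

## Honest column / NOT here

* EXISTENCE ONLY, and as SECOND PROOFS (duplication notice above): Theorem 4's completeness ("the only isogenies") is NOT typed for
  general `n` (the siblings have complete lists at `N = 8`, `16`, `32`).  A numerical enumeration (this seat, `N = 8, …, 128`) finds, among pairs with an odd entry and modulo a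
  common unit and permutations, exactly the three coincidence classes typed here (e)₀, d)₀, and a)₀ with the two e)₁ triples) and no
  other; in particular the printed families a) (second triple) and c) consist of pairs `τ′ = uτ` that are "obvious" in the sense of
  p. 1185 (typed for every `n` in §5), and the illegible family b) contributes nothing new at these levels.  This is an observation about
  our copy of the text, not a claim about the theorem; the typed statements are members K–R print (d), e), "furthermore").
* The road (parity criterion) is ours, not K–R's §5 (pp. 1201–1205).  Levels `m ≥ 1` are pull-backs and are not restated.  "Isogeny of
  lattices" = equality of residue sets at the full level, as in every sibling.

## References

* [KoblitzRohrlich1978] N. Koblitz, D. Rohrlich, Canad. J. Math. 30 (1978) 1183–1205: Theorem 4 (p. 1186), §5 (pp. 1201–1205), §2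
  (pp. 1187–1188).

## Provenance

Cell `pub-hodgecm2` (COR-CM), literature seat `lit-deligne-3` gen 37 (claim KR78-THM4-FAMILIES; count-neutral, own lane); §5 appended
by the same seat (claim KR78-THM4-OBVIOUS, append-only v2); v3 (claim KR78-THM4-XREF) changes docstrings only: duplication
notice and cross-references to the gen-36 first proofs.
-/

noncomputable section

open NumberField

namespace Literature.AlgebraicGeometry.ComplexMultiplication

open Literature.AlgebraicGeometry.HodgeTheory (fermatCMType)

namespace CyclotomicFermatCMType

/-! ## §1 Tools: valuations of `pᵏ·u`, the fibres `2x = 2c`, `4x = 4c`, `N₁x = N₁` modulo `2ⁿ` -/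

section Tools

variable {p : ℕ} [hp : Fact p.Prime] {n : ℕ}

/-- `pʲ ≠ 0` modulo `pⁿ` for `j < n` (bookkeeping for K–R's "`ord`", "`N₁ = 3ⁿ⁻¹`"). [cite: KoblitzRohrlich1978, §4 (p. 1198)] -/
theorem pow_natCast_ne_zero_of_lt {j : ℕ} (hj : j < n) : (p : ZMod (p ^ n)) ^ j ≠ 0 := by
  intro h
  rw [← Nat.cast_pow, ZMod.natCast_eq_zero_iff] at h
  exact absurd (Nat.le_of_dvd (pow_pos hp.out.pos j) h) (not_le.2 (Nat.pow_lt_pow_right hp.out.one_lt hj))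

/-- **The valuation of `pᵏ·u` is `k`** (`u` a unit, `k < n`): "`ord m` = the highest power … that divides `m`", for residues written as
a power of `p` times a unit. [cite: KoblitzRohrlich1978, §4 proof of the Proposition (p. 1198)] -/
theorem factorization_val_pow_mul {k : ℕ} (hk : k < n) {u : ZMod (p ^ n)} (hu : IsUnit u) :
    ((p : ZMod (p ^ n)) ^ k * u).val.factorization p = k := by
  have hn : n ≠ 0 := by omega
  have ha : (p : ZMod (p ^ n)) ^ k * u ≠ 0 := fun h => pow_natCast_ne_zero_of_lt hk (hu.mul_left_eq_zero.mp h)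
  obtain ⟨hv, a₀, ha₀, e⟩ := exists_eq_pow_mul_unit_primePow ha
  -- two representations `pⁱ·b = pʲ·c` with units `b, c` and `i < j < n` are impossible
  have key : ∀ {i j : ℕ} {b c : ZMod (p ^ n)}, IsUnit b → j < n → i < j →
      (p : ZMod (p ^ n)) ^ i * b = (p : ZMod (p ^ n)) ^ j * c → False := by
    intro i j b c hb hj hij h
    have h1 : (p : ZMod (p ^ n)) ^ i * (b - (p : ZMod (p ^ n)) ^ (j - i) * c) = 0 := by
      rw [mul_sub, h, ← mul_assoc, ← pow_add, Nat.add_sub_cancel' hij.le, sub_self]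
    have h2 : IsUnit (b - (p : ZMod (p ^ n)) ^ (j - i) * c) := by
      by_contra hnu
      have hb' : ZMod.castHom (dvd_pow_self p hn) (ZMod p) b ≠ 0 :=
        fun h0 => ((not_isUnit_iff_castHom_eq_zero hn b).2 h0) hb
      apply hb'
      have h3 := (not_isUnit_iff_castHom_eq_zero hn _).1 hnu
      rwa [map_sub, map_mul, map_pow, map_natCast, ZMod.natCast_self, zero_pow (by omega : j - i ≠ 0), zero_mul,
        sub_zero] at h3
    exact pow_natCast_ne_zero_of_lt (lt_trans hij hj) (h2.mul_left_eq_zero.mp h1)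
  rcases lt_trichotomy k (((p : ZMod (p ^ n)) ^ k * u).val.factorization p) with h | h | h
  · exact (key hu hv h e).elim
  · exact h.symm
  · exact (key ha₀ hk h e.symm).elim

/-- **`2y = 0` modulo `2ⁿ` iff `y ∈ {0, 2ⁿ⁻¹}`** (`n ≥ 1`). [cite: KoblitzRohrlich1978, §5 (p. 1201)] -/
theorem two_mul_eq_zero_iff_twoPow (hn : n ≠ 0) (y : ZMod (2 ^ n)) :
    (2 : ZMod (2 ^ n)) * y = 0 ↔ y = 0 ∨ y = (2 : ZMod (2 ^ n)) ^ (n - 1) := by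
  have hN : 2 ^ n = 2 * 2 ^ (n - 1) := by rw [← pow_succ']; congr 1; omega
  constructor
  · intro h
    have h1 : ((2 * y.val : ℕ) : ZMod (2 ^ n)) = 0 := by push_cast; rw [ZMod.natCast_zmod_val]; exact h
    rw [ZMod.natCast_eq_zero_iff] at h1
    have h1' : 2 * 2 ^ (n - 1) ∣ 2 * y.val := by rw [← hN]; exact h1
    obtain ⟨c, hc⟩ := Nat.dvd_of_mul_dvd_mul_left (by norm_num : 0 < 2) h1'
    have hlt : y.val < 2 * 2 ^ (n - 1) := lt_of_lt_of_eq (ZMod.val_lt y) hN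
    rw [hc] at hlt
    have hc2 : c < 2 := by
      by_contra hc2
      push Not at hc2
      have := Nat.mul_le_mul_left (2 ^ (n - 1)) hc2
      omega
    interval_cases c
    · left
      apply (ZMod.val_eq_zero y).1
      omega
    · right
      conv_lhs => rw [← ZMod.natCast_zmod_val y, hc, mul_one]
      rw [Nat.cast_pow, Nat.cast_ofNat]
  · rintro (rfl | rfl)
    · rw [mul_zero]
    · rw [← pow_succ', show n - 1 + 1 = n by omega]
      have h := ZMod.natCast_self (2 ^ n)
      push_cast at h
      exact h

/-- **The fibre of an entry of valuation `1`**: `2x = 2c` modulo `2ⁿ` iff `x ∈ {c, c + 2ⁿ⁻¹}`. [cite: KoblitzRohrlich1978, §5 (p. 1201)] -/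
theorem two_mul_eq_two_mul_iff_twoPow (hn : n ≠ 0) (x c : ZMod (2 ^ n)) :
    (2 : ZMod (2 ^ n)) * x = 2 * c ↔ x = c ∨ x = c + (2 : ZMod (2 ^ n)) ^ (n - 1) := by
  rw [← sub_eq_zero, ← mul_sub, two_mul_eq_zero_iff_twoPow hn, sub_eq_zero, sub_eq_iff_eq_add']

/-- **The fibre of an entry of valuation `2`**: `4x = 4c` modulo `2ⁿ` iff `x ∈ {c, c + 2ⁿ⁻¹}` or `2(x − c) = 2ⁿ⁻¹`.
[cite: KoblitzRohrlich1978, §5 (p. 1201)] -/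
theorem four_mul_eq_four_mul_iff_twoPow (hn : n ≠ 0) (x c : ZMod (2 ^ n)) :
    (2 : ZMod (2 ^ n)) ^ 2 * x = 2 ^ 2 * c ↔ (x = c ∨ x = c + (2 : ZMod (2 ^ n)) ^ (n - 1)) ∨ 2 * (x - c) = (2 : ZMod (2 ^ n)) ^ (n - 1) := by
  rw [← sub_eq_zero, ← mul_sub, pow_two, mul_assoc, two_mul_eq_zero_iff_twoPow hn, mul_sub, sub_eq_zero,
    two_mul_eq_two_mul_iff_twoPow hn, ← mul_sub]

/-- **The fibre of `2ⁿ⁻¹` is all of the units**: `2ⁿ⁻¹·x = 2ⁿ⁻¹` for every odd `x` (`n ≥ 1`). [cite: KoblitzRohrlich1978, §5 (p. 1201)] -/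
theorem pow_pred_mul_eq_of_isUnit_twoPow (hn : n ≠ 0) {x : ZMod (2 ^ n)} (hx : IsUnit x) :
    (2 : ZMod (2 ^ n)) ^ (n - 1) * x = (2 : ZMod (2 ^ n)) ^ (n - 1) := by
  haveI : Fact (Nat.Prime 2) := ⟨Nat.prime_two⟩
  -- `x = 1 + 2y`
  have hodd : x.val % 2 = 1 := by
    have hc : x.val.Coprime (2 ^ n) := by
      have h := (ZMod.isUnit_iff_coprime x.val (2 ^ n))
      rw [ZMod.natCast_zmod_val] at h
      exact h.1 hx
    have h2 : x.val.Coprime 2 := Nat.Coprime.coprime_dvd_right (dvd_pow_self 2 hn) hc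
    rcases Nat.mod_two_eq_zero_or_one x.val with h0 | h1
    · exact absurd (Nat.Coprime.eq_one_of_dvd h2.symm (Nat.dvd_of_mod_eq_zero h0)) (by norm_num)
    · exact h1
  have ex : x = 1 + 2 * ((x.val / 2 : ℕ) : ZMod (2 ^ n)) := by
    conv_lhs => rw [← ZMod.natCast_zmod_val x, ← Nat.div_add_mod x.val 2, hodd]
    push_cast
    ring
  have h2n : (2 : ZMod (2 ^ n)) ^ (n - 1) * 2 = 0 := by
    rw [← pow_succ, show n - 1 + 1 = n by omega]
    have h := ZMod.natCast_self (2 ^ n)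
    push_cast at h
    exact h
  rw [ex, mul_add, mul_one, ← mul_assoc, h2n, zero_mul, add_zero]

/-- A residue modulo `2ⁿ` with non-zero reduction modulo `2` (an odd residue) is a unit. [cite: KoblitzRohrlich1978, §5 (p. 1201)] -/
theorem isUnit_of_castHom_two_ne_zero (hn : n ≠ 0) {a : ZMod (2 ^ n)}
    (h : ZMod.castHom (dvd_pow_self 2 hn) (ZMod 2) a ≠ 0) : IsUnit a := by
  haveI : Fact (Nat.Prime 2) := ⟨Nat.prime_two⟩
  by_contra hau
  exact h ((not_isUnit_iff_castHom_eq_zero hn a).1 hau)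

/-- Disjoint alternatives add: `[P ∨ Q] = [P] + [Q]` when `P`, `Q` exclude each other. [folklore] -/
private theorem ite_or_eq_add {P Q : Prop} [Decidable P] [Decidable Q] (h : ¬(P ∧ Q)) :
    (if P ∨ Q then (1 : ℕ) else 0) = (if P then 1 else 0) + (if Q then 1 else 0) := by
  by_cases hP : P <;> by_cases hQ : Q <;> simp_all

end Tools

/-! ## §2 Family e): `H_{(1, 2ⁿ⁻¹ − 1, 2ⁿ⁻¹)} = H_{(1, 1, 2ⁿ − 2)}` for every `n ≥ 3` -/

section FamilyE

variable {n : ℕ}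

/-- **THEOREM 4 e), `m = 0`, EVERY `n ≥ 3`**: `H_{(1, 2ⁿ⁻¹ − 1, 2ⁿ⁻¹)} = H_{(1, 1, 2ⁿ − 2)}` modulo `2ⁿ` — "e) `(2ᵐ, 2ⁿ⁻¹, 2ⁿ⁻¹ − 2ᵐ)` and
`(2ᵐ, 2ᵐ, 2ⁿ − 2ᵐ⁺¹)`".  By the parity criterion: `μ_{(1,1,−2)}(x) = 2[x = 1] + [x ∈ {−1, N₁ − 1}]`, `μ_{(1,N₁−1,N₁)}(x) = [x = 1] +
[x = N₁ − 1] + 1`, whose difference `[x = 1] + [x = −1] − 1` is even.  SECOND PROOF of the sibling's `fermatCMType_twoPow_e_eq` (gen 36). [cite: KoblitzRohrlich1978, Theorem 4 e) (p. 1186)] -/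
theorem fermatCMType_twoPow_e (hn : 3 ≤ n) :
    fermatCMType (2 ^ n) 1 (-1 + (2 : ZMod (2 ^ n)) ^ (n - 1)) ((2 : ZMod (2 ^ n)) ^ (n - 1)) =
      fermatCMType (2 ^ n) 1 1 (-2) := by
  haveI : Fact (Nat.Prime 2) := ⟨Nat.prime_two⟩
  have hn0 : n ≠ 0 := by omega
  haveI : Fact (1 < 2 ^ n) := ⟨Nat.one_lt_pow hn0 (by norm_num)⟩
  set H : ZMod (2 ^ n) := (2 : ZMod (2 ^ n)) ^ (n - 1) with hH
  have hH0 : H ≠ 0 := pow_natCast_ne_zero_of_lt (p := 2) (by omega)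
  have h2H : (2 : ZMod (2 ^ n)) * H = 0 := by
    rw [hH, ← pow_succ', show n - 1 + 1 = n by omega]
    have h := ZMod.natCast_self (2 ^ n)
    push_cast at h
    exact h
  have hnegH : -H = H := by linear_combination -h2H
  have h20 : (2 : ZMod (2 ^ n)) ≠ 0 := by
    have := pow_natCast_ne_zero_of_lt (p := 2) (n := n) (j := 1) (by omega)
    rwa [pow_one] at this
  -- units and valuations of the entries
  have hc2 : ZMod.castHom (dvd_pow_self 2 hn0) (ZMod 2) (2 : ZMod (2 ^ n)) = 0 := by
    rw [show (2 : ZMod (2 ^ n)) = ((2 : ℕ) : ZMod (2 ^ n)) by norm_num, map_natCast, ZMod.natCast_self]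
  have hcH : ZMod.castHom (dvd_pow_self 2 hn0) (ZMod 2) H = 0 := by
    rw [hH, map_pow, hc2, zero_pow (by omega)]
  have huH1 : IsUnit (-1 + H) :=
    isUnit_of_castHom_two_ne_zero hn0 (by rw [map_add, map_neg, map_one, hcH, add_zero]; exact neg_ne_zero.2 one_ne_zero)
  have fm2 : (-2 : ZMod (2 ^ n)).val.factorization 2 = 1 := by
    have h := factorization_val_pow_mul (p := 2) (n := n) (k := 1) (by omega) (isUnit_one.neg)
    rwa [pow_one, Nat.cast_ofNat, mul_neg, mul_one] at h
  have fH : H.val.factorization 2 = n - 1 := by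
    have h := factorization_val_pow_mul (p := 2) (n := n) (k := n - 1) (by omega) isUnit_one
    rwa [mul_one, Nat.cast_ofNat] at h
  -- the predicates of the criterion, entry by entry
  have P1 : ∀ y : ZMod (2 ^ n), ((2 : ℕ) : ZMod (2 ^ n)) ^ ((1 : ZMod (2 ^ n)).val.factorization 2) * y = 1 ↔ y = 1 :=
    fun y => pow_factorization_mul_eq_iff_of_isUnit hn0 isUnit_one y
  have P2 : ∀ y : ZMod (2 ^ n), ((2 : ℕ) : ZMod (2 ^ n)) ^ ((-1 + H).val.factorization 2) * y = -1 + H ↔ y = -1 + H :=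
    fun y => pow_factorization_mul_eq_iff_of_isUnit hn0 huH1 y
  have P3 : ∀ y : ZMod (2 ^ n), ((2 : ℕ) : ZMod (2 ^ n)) ^ ((-2 : ZMod (2 ^ n)).val.factorization 2) * y = -2 ↔
      y = -1 ∨ y = -1 + H := by
    intro y
    rw [fm2, pow_one, Nat.cast_ofNat, show (-2 : ZMod (2 ^ n)) = 2 * (-1) by ring, two_mul_eq_two_mul_iff_twoPow hn0]
  have P4 : ∀ {y : ZMod (2 ^ n)}, IsUnit y → (((2 : ℕ) : ZMod (2 ^ n)) ^ (H.val.factorization 2) * y = H ↔ True) := by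
    intro y hy
    rw [fH, Nat.cast_ofNat, iff_true]
    exact pow_pred_mul_eq_of_isUnit_twoPow hn0 hy
  -- the criterion
  refine fermatCMType_eq_of_forall_countP (p := 2) hn0 one_ne_zero one_ne_zero (neg_ne_zero.2 h20) (by ring) one_ne_zero
    huH1.ne_zero hH0 (by linear_combination h2H) fun x hx => ?_
  have hxn : IsUnit (-x) := hx.neg
  -- normal forms of the conditions at `−x`
  have n0 : -x = -1 ↔ x = 1 := neg_inj
  have n1 : -x = 1 ↔ x = -1 := neg_eq_iff_eq_neg
  have n2 : -x = -1 + H ↔ x = 1 + H := by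
    rw [neg_eq_iff_eq_neg, neg_add, neg_neg, hnegH]
  have d1 : ¬(x = -1 ∧ x = -1 + H) := fun ⟨h1, h2⟩ => hH0 (by linear_combination h1 - h2)
  have d2 : ¬(x = 1 ∧ x = 1 + H) := fun ⟨h1, h2⟩ => hH0 (by linear_combination h1 - h2)
  simp only [Multiset.insert_eq_cons, ← Multiset.cons_zero, Multiset.countP_cons, Multiset.countP_zero, P1, P2, P3, P4 hx,
    P4 hxn, n0, n1, n2, ite_or_eq_add d1, ite_or_eq_add d2, if_true]
  ring

end FamilyE

/-! ## §3 Family d): `H_{(3, 2ⁿ⁻¹ − 2, 2ⁿ⁻¹ − 1)} = H_{(1, 3, 2ⁿ − 4)}` for every `n ≥ 3` -/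

section FamilyD

variable {n : ℕ}

/-- **THEOREM 4 d), `m = 0`, EVERY `n ≥ 3`**: `H_{(3, 2ⁿ⁻¹ − 2, 2ⁿ⁻¹ − 1)} = H_{(1, 3, 2ⁿ − 4)}` modulo `2ⁿ` — "d) `(2ᵐ, 3(2ᵐ), 2ⁿ − 2ᵐ⁺²)`
and `(2ⁿ⁻¹ − 2ᵐ, 2ⁿ⁻¹ − 2ᵐ⁺¹, 3(2ᵐ))`".  By the parity criterion with the fibres `4y = −4 ⟺ 2y = −2 ∨ 2y = 2(2ⁿ⁻² − 1)` and
`2y = 2ⁿ⁻¹ − 2 ⟺ 2y = 2(2ⁿ⁻² − 1)`: the multiplicity functions differ by `[x = 1] + [2x = −2] − [x = 2ⁿ⁻¹ − 1]`, an even function.  SECOND PROOF of the sibling's `fermatCMType_twoPow_d_eq` (gen 36).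
[cite: KoblitzRohrlich1978, Theorem 4 d) (p. 1186)] -/
theorem fermatCMType_twoPow_d (hn : 3 ≤ n) :
    fermatCMType (2 ^ n) 3 (-2 + (2 : ZMod (2 ^ n)) ^ (n - 1)) (-1 + (2 : ZMod (2 ^ n)) ^ (n - 1)) =
      fermatCMType (2 ^ n) 1 3 (-4) := by
  have h3two : (3 : ZMod 2) ≠ 0 := by decide
  haveI : Fact (Nat.Prime 2) := ⟨Nat.prime_two⟩
  have hn0 : n ≠ 0 := by omega
  haveI : Fact (1 < 2 ^ n) := ⟨Nat.one_lt_pow hn0 (by norm_num)⟩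
  set H : ZMod (2 ^ n) := (2 : ZMod (2 ^ n)) ^ (n - 1) with hH
  set H' : ZMod (2 ^ n) := (2 : ZMod (2 ^ n)) ^ (n - 2) with hH'
  have hH0 : H ≠ 0 := pow_natCast_ne_zero_of_lt (p := 2) (by omega)
  have h2H : (2 : ZMod (2 ^ n)) * H = 0 := by
    rw [hH, ← pow_succ', show n - 1 + 1 = n by omega]
    have h := ZMod.natCast_self (2 ^ n)
    push_cast at h
    exact h
  have hnegH : -H = H := by linear_combination -h2H
  have h2H' : (2 : ZMod (2 ^ n)) * H' = H := by rw [hH', hH, ← pow_succ', show n - 2 + 1 = n - 1 by omega]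
  have h20 : (2 : ZMod (2 ^ n)) ≠ 0 := by
    have := pow_natCast_ne_zero_of_lt (p := 2) (n := n) (j := 1) (by omega)
    rwa [pow_one] at this
  -- reductions modulo `2`, units
  have hc2 : ZMod.castHom (dvd_pow_self 2 hn0) (ZMod 2) (2 : ZMod (2 ^ n)) = 0 := by
    rw [show (2 : ZMod (2 ^ n)) = ((2 : ℕ) : ZMod (2 ^ n)) by norm_num, map_natCast, ZMod.natCast_self]
  have hcH : ZMod.castHom (dvd_pow_self 2 hn0) (ZMod 2) H = 0 := by rw [hH, map_pow, hc2, zero_pow (by omega)]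
  have hcH' : ZMod.castHom (dvd_pow_self 2 hn0) (ZMod 2) H' = 0 := by rw [hH', map_pow, hc2, zero_pow (by omega)]
  have hu3 : IsUnit (3 : ZMod (2 ^ n)) := isUnit_of_castHom_two_ne_zero hn0 (by rw [map_ofNat]; exact h3two)
  have huH1 : IsUnit (-1 + H) :=
    isUnit_of_castHom_two_ne_zero hn0 (by rw [map_add, map_neg, map_one, hcH, add_zero]; exact neg_ne_zero.2 one_ne_zero)
  have huH'1 : IsUnit (-1 + H') :=
    isUnit_of_castHom_two_ne_zero hn0 (by rw [map_add, map_neg, map_one, hcH', add_zero]; exact neg_ne_zero.2 one_ne_zero)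
  -- valuations
  have fm4 : (-4 : ZMod (2 ^ n)).val.factorization 2 = 2 := by
    have h := factorization_val_pow_mul (p := 2) (n := n) (k := 2) (by omega) (isUnit_one.neg)
    rwa [Nat.cast_ofNat, show (2 : ZMod (2 ^ n)) ^ 2 * -1 = -4 by ring] at h
  have fHm2 : (-2 + H).val.factorization 2 = 1 := by
    have h := factorization_val_pow_mul (p := 2) (n := n) (k := 1) (by omega) huH'1
    rwa [Nat.cast_ofNat, pow_one, show (2 : ZMod (2 ^ n)) * (-1 + H') = -2 + H by linear_combination h2H'] at h
  -- predicates
  have P1 : ∀ y : ZMod (2 ^ n), ((2 : ℕ) : ZMod (2 ^ n)) ^ ((1 : ZMod (2 ^ n)).val.factorization 2) * y = 1 ↔ y = 1 :=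
    fun y => pow_factorization_mul_eq_iff_of_isUnit hn0 isUnit_one y
  have P3 : ∀ y : ZMod (2 ^ n), ((2 : ℕ) : ZMod (2 ^ n)) ^ ((3 : ZMod (2 ^ n)).val.factorization 2) * y = 3 ↔ y = 3 :=
    fun y => pow_factorization_mul_eq_iff_of_isUnit hn0 hu3 y
  have PH1 : ∀ y : ZMod (2 ^ n), ((2 : ℕ) : ZMod (2 ^ n)) ^ ((-1 + H).val.factorization 2) * y = -1 + H ↔ y = -1 + H :=
    fun y => pow_factorization_mul_eq_iff_of_isUnit hn0 huH1 y
  have Pm4 : ∀ y : ZMod (2 ^ n), ((2 : ℕ) : ZMod (2 ^ n)) ^ ((-4 : ZMod (2 ^ n)).val.factorization 2) * y = -4 ↔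
      2 * y = 2 * (-1) ∨ 2 * y = 2 * (-1 + H') := by
    intro y
    rw [fm4, Nat.cast_ofNat]
    constructor
    · intro h
      have h1 : (2 : ZMod (2 ^ n)) * (2 * y + 2) = 0 := by linear_combination h
      rcases (two_mul_eq_zero_iff_twoPow hn0 _).1 h1 with h2 | h2
      · left; linear_combination h2
      · right; linear_combination h2 - h2H'
    · rintro (h | h)
      · linear_combination 2 * h
      · linear_combination 2 * h + 2 * h2H' + h2H
  have PHm2 : ∀ y : ZMod (2 ^ n), ((2 : ℕ) : ZMod (2 ^ n)) ^ ((-2 + H).val.factorization 2) * y = -2 + H ↔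
      2 * y = 2 * (-1 + H') := by
    intro y
    rw [fHm2, Nat.cast_ofNat, pow_one, show (-2 + H : ZMod (2 ^ n)) = 2 * (-1 + H') by linear_combination -h2H']
  -- the criterion
  refine fermatCMType_eq_of_forall_countP (p := 2) hn0 one_ne_zero hu3.ne_zero (neg_ne_zero.2 ?_) (by ring) hu3.ne_zero ?_
    huH1.ne_zero (by linear_combination h2H) fun x hx => ?_
  · have := pow_natCast_ne_zero_of_lt (p := 2) (n := n) (j := 2) (by omega)
    rwa [Nat.cast_ofNat, show (2 : ZMod (2 ^ n)) ^ 2 = 4 by norm_num] at this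
  · rw [show (-2 + H : ZMod (2 ^ n)) = 2 * (-1 + H') by linear_combination -h2H']
    exact fun h => h20 (huH'1.mul_left_eq_zero.mp h)
  -- normal forms at `−x`, splittings
  have n1 : -x = 1 ↔ x = -1 := neg_eq_iff_eq_neg
  have n3 : -x = 3 ↔ x = -3 := neg_eq_iff_eq_neg
  have n2 : -x = -1 + H ↔ x = 1 + H := by rw [neg_eq_iff_eq_neg, neg_add, neg_neg, hnegH]
  have m0 : 2 * -x = 2 * (-1) ↔ (2 : ZMod (2 ^ n)) * x = 2 * 1 := by
    constructor <;> intro h <;> linear_combination -h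
  have m1 : 2 * -x = 2 * (-1 + H') ↔ (2 : ZMod (2 ^ n)) * x = 2 * (1 - H') := by
    constructor <;> intro h <;> linear_combination -h
  have dA : ¬((2 : ZMod (2 ^ n)) * x = 2 * (-1) ∧ 2 * x = 2 * (-1 + H')) :=
    fun ⟨h1, h2⟩ => hH0 (by linear_combination h1 - h2 - h2H')
  have dB : ¬((2 : ZMod (2 ^ n)) * x = 2 * 1 ∧ 2 * x = 2 * (1 - H')) :=
    fun ⟨h1, h2⟩ => hH0 (by linear_combination h2 - h1 - h2H')
  have S1 : (2 : ZMod (2 ^ n)) * x = 2 * (-1) ↔ x = -1 ∨ x = -1 + H := two_mul_eq_two_mul_iff_twoPow hn0 x (-1)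
  have S2 : (2 : ZMod (2 ^ n)) * x = 2 * 1 ↔ x = 1 ∨ x = 1 + H := two_mul_eq_two_mul_iff_twoPow hn0 x 1
  have d1 : ¬(x = -1 ∧ x = -1 + H) := fun ⟨h1, h2⟩ => hH0 (by linear_combination h1 - h2)
  have d2 : ¬(x = 1 ∧ x = 1 + H) := fun ⟨h1, h2⟩ => hH0 (by linear_combination h1 - h2)
  simp only [Multiset.insert_eq_cons, ← Multiset.cons_zero, Multiset.countP_cons, Multiset.countP_zero, P1, P3, PH1, Pm4, PHm2,
    n1, n3, n2, m0, m1]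
  simp only [ite_or_eq_add dA, ite_or_eq_add dB]
  simp only [S1, S2, ite_or_eq_add d1, ite_or_eq_add d2]
  ring

end FamilyD

/-! ## §4 The "furthermore": `H_{(1, 2ⁿ⁻¹ − 2, 2ⁿ⁻¹ + 1)} = H_{(2, 2, 2ⁿ − 4)} = H_{(2, 2ⁿ⁻¹ − 2, 2ⁿ⁻¹)}` for every `n ≥ 3` -/

section Furthermore

variable {n : ℕ}

/-- **THEOREM 4, "a lattice of type a)ₘ is isogenous to the product of two lattices of type e)ₘ₊₁", `m = 0`, EVERY `n ≥ 3` — first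
half**: `H_{(2, 2, 2ⁿ − 4)} = H_{(1, 2ⁿ⁻¹ − 2, 2ⁿ⁻¹ + 1)}` modulo `2ⁿ` (the a)₀ triple `(2ᵐ, 2ⁿ⁻¹ − 2ᵐ⁺¹, 2ⁿ⁻¹ + 2ᵐ)` at `m = 0` and the
e)₁ triple `(2ᵐ, 2ᵐ, 2ⁿ − 2ᵐ⁺¹)` at `m = 1`, a pull-back from level `2ⁿ⁻¹`).  Parity criterion as in §§2–3.  SECOND PROOF of the sibling's `fermatCMType_twoPow_furthermore_snd_eq` (gen 36).
[cite: KoblitzRohrlich1978, Theorem 4 a), e) and "Furthermore" (p. 1186)] -/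
theorem fermatCMType_twoPow_a_e₁ (hn : 3 ≤ n) :
    fermatCMType (2 ^ n) 2 2 (-4) = fermatCMType (2 ^ n) 1 (-2 + (2 : ZMod (2 ^ n)) ^ (n - 1)) (1 + (2 : ZMod (2 ^ n)) ^ (n - 1)) := by
  haveI : Fact (Nat.Prime 2) := ⟨Nat.prime_two⟩
  have hn0 : n ≠ 0 := by omega
  haveI : Fact (1 < 2 ^ n) := ⟨Nat.one_lt_pow hn0 (by norm_num)⟩
  set H : ZMod (2 ^ n) := (2 : ZMod (2 ^ n)) ^ (n - 1) with hH
  set H' : ZMod (2 ^ n) := (2 : ZMod (2 ^ n)) ^ (n - 2) with hH'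
  have hH0 : H ≠ 0 := pow_natCast_ne_zero_of_lt (p := 2) (by omega)
  have h2H : (2 : ZMod (2 ^ n)) * H = 0 := by
    rw [hH, ← pow_succ', show n - 1 + 1 = n by omega]
    have h := ZMod.natCast_self (2 ^ n)
    push_cast at h
    exact h
  have hnegH : -H = H := by linear_combination -h2H
  have h2H' : (2 : ZMod (2 ^ n)) * H' = H := by rw [hH', hH, ← pow_succ', show n - 2 + 1 = n - 1 by omega]
  have h20 : (2 : ZMod (2 ^ n)) ≠ 0 := by
    have := pow_natCast_ne_zero_of_lt (p := 2) (n := n) (j := 1) (by omega)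
    rwa [pow_one] at this
  have hc2 : ZMod.castHom (dvd_pow_self 2 hn0) (ZMod 2) (2 : ZMod (2 ^ n)) = 0 := by
    rw [show (2 : ZMod (2 ^ n)) = ((2 : ℕ) : ZMod (2 ^ n)) by norm_num, map_natCast, ZMod.natCast_self]
  have hcH : ZMod.castHom (dvd_pow_self 2 hn0) (ZMod 2) H = 0 := by rw [hH, map_pow, hc2, zero_pow (by omega)]
  have hcH' : ZMod.castHom (dvd_pow_self 2 hn0) (ZMod 2) H' = 0 := by rw [hH', map_pow, hc2, zero_pow (by omega)]
  have huH1 : IsUnit (1 + H) :=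
    isUnit_of_castHom_two_ne_zero hn0 (by rw [map_add, map_one, hcH, add_zero]; exact one_ne_zero)
  have huH'1 : IsUnit (-1 + H') :=
    isUnit_of_castHom_two_ne_zero hn0 (by rw [map_add, map_neg, map_one, hcH', add_zero]; exact neg_ne_zero.2 one_ne_zero)
  have fm4 : (-4 : ZMod (2 ^ n)).val.factorization 2 = 2 := by
    have h := factorization_val_pow_mul (p := 2) (n := n) (k := 2) (by omega) (isUnit_one.neg)
    rwa [Nat.cast_ofNat, show (2 : ZMod (2 ^ n)) ^ 2 * -1 = -4 by ring] at h
  have f2 : (2 : ZMod (2 ^ n)).val.factorization 2 = 1 := by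
    have h := factorization_val_pow_mul (p := 2) (n := n) (k := 1) (by omega) isUnit_one
    rwa [Nat.cast_ofNat, pow_one, mul_one] at h
  have fHm2 : (-2 + H).val.factorization 2 = 1 := by
    have h := factorization_val_pow_mul (p := 2) (n := n) (k := 1) (by omega) huH'1
    rwa [Nat.cast_ofNat, pow_one, show (2 : ZMod (2 ^ n)) * (-1 + H') = -2 + H by linear_combination h2H'] at h
  have P1 : ∀ y : ZMod (2 ^ n), ((2 : ℕ) : ZMod (2 ^ n)) ^ ((1 : ZMod (2 ^ n)).val.factorization 2) * y = 1 ↔ y = 1 :=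
    fun y => pow_factorization_mul_eq_iff_of_isUnit hn0 isUnit_one y
  have PH1 : ∀ y : ZMod (2 ^ n), ((2 : ℕ) : ZMod (2 ^ n)) ^ ((1 + H).val.factorization 2) * y = 1 + H ↔ y = 1 + H :=
    fun y => pow_factorization_mul_eq_iff_of_isUnit hn0 huH1 y
  have P2 : ∀ y : ZMod (2 ^ n), ((2 : ℕ) : ZMod (2 ^ n)) ^ ((2 : ZMod (2 ^ n)).val.factorization 2) * y = 2 ↔ 2 * y = 2 * 1 := by
    intro y; rw [f2, Nat.cast_ofNat, pow_one, mul_one]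
  have Pm4 : ∀ y : ZMod (2 ^ n), ((2 : ℕ) : ZMod (2 ^ n)) ^ ((-4 : ZMod (2 ^ n)).val.factorization 2) * y = -4 ↔
      2 * y = 2 * (-1) ∨ 2 * y = 2 * (-1 + H') := by
    intro y
    rw [fm4, Nat.cast_ofNat]
    constructor
    · intro h
      have h1 : (2 : ZMod (2 ^ n)) * (2 * y + 2) = 0 := by linear_combination h
      rcases (two_mul_eq_zero_iff_twoPow hn0 _).1 h1 with h2 | h2
      · left; linear_combination h2
      · right; linear_combination h2 - h2H'
    · rintro (h | h)
      · linear_combination 2 * h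
      · linear_combination 2 * h + 2 * h2H' + h2H
  have PHm2 : ∀ y : ZMod (2 ^ n), ((2 : ℕ) : ZMod (2 ^ n)) ^ ((-2 + H).val.factorization 2) * y = -2 + H ↔
      2 * y = 2 * (-1 + H') := by
    intro y
    rw [fHm2, Nat.cast_ofNat, pow_one, show (-2 + H : ZMod (2 ^ n)) = 2 * (-1 + H') by linear_combination -h2H']
  have hm40 : (-4 : ZMod (2 ^ n)) ≠ 0 := by
    apply neg_ne_zero.2
    have := pow_natCast_ne_zero_of_lt (p := 2) (n := n) (j := 2) (by omega)
    rwa [Nat.cast_ofNat, show (2 : ZMod (2 ^ n)) ^ 2 = 4 by norm_num] at this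
  have hHm20 : (-2 + H : ZMod (2 ^ n)) ≠ 0 := by
    rw [show (-2 + H : ZMod (2 ^ n)) = 2 * (-1 + H') by linear_combination -h2H']
    exact fun h => h20 (huH'1.mul_left_eq_zero.mp h)
  refine fermatCMType_eq_of_forall_countP (p := 2) hn0 one_ne_zero hHm20 huH1.ne_zero (by linear_combination h2H) h20 h20 hm40
    (by ring) fun x hx => ?_
  have n1 : -x = 1 ↔ x = -1 := neg_eq_iff_eq_neg
  have n2' : -x = 1 + H ↔ x = -1 + H := by rw [neg_eq_iff_eq_neg, neg_add, hnegH]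
  have m0 : 2 * -x = 2 * (-1) ↔ (2 : ZMod (2 ^ n)) * x = 2 * 1 := by
    constructor <;> intro h <;> linear_combination -h
  have m0' : 2 * -x = 2 * 1 ↔ (2 : ZMod (2 ^ n)) * x = 2 * (-1) := by
    constructor <;> intro h <;> linear_combination -h
  have m1 : 2 * -x = 2 * (-1 + H') ↔ (2 : ZMod (2 ^ n)) * x = 2 * (1 - H') := by
    constructor <;> intro h <;> linear_combination -h
  have dA : ¬((2 : ZMod (2 ^ n)) * x = 2 * (-1) ∧ 2 * x = 2 * (-1 + H')) :=
    fun ⟨h1, h2⟩ => hH0 (by linear_combination h1 - h2 - h2H')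
  have dB : ¬((2 : ZMod (2 ^ n)) * x = 2 * 1 ∧ 2 * x = 2 * (1 - H')) :=
    fun ⟨h1, h2⟩ => hH0 (by linear_combination h2 - h1 - h2H')
  have S1 : (2 : ZMod (2 ^ n)) * x = 2 * (-1) ↔ x = -1 ∨ x = -1 + H := two_mul_eq_two_mul_iff_twoPow hn0 x (-1)
  have S2 : (2 : ZMod (2 ^ n)) * x = 2 * 1 ↔ x = 1 ∨ x = 1 + H := two_mul_eq_two_mul_iff_twoPow hn0 x 1
  have d1 : ¬(x = -1 ∧ x = -1 + H) := fun ⟨h1, h2⟩ => hH0 (by linear_combination h1 - h2)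
  have d2 : ¬(x = 1 ∧ x = 1 + H) := fun ⟨h1, h2⟩ => hH0 (by linear_combination h1 - h2)
  simp only [Multiset.insert_eq_cons, ← Multiset.cons_zero, Multiset.countP_cons, Multiset.countP_zero, P1, PH1, P2, Pm4, PHm2,
    n1, n2', m0, m0', m1]
  simp only [ite_or_eq_add dA, ite_or_eq_add dB]
  simp only [S1, S2, ite_or_eq_add d1, ite_or_eq_add d2]
  ring

/-- **THEOREM 4, the "furthermore", second half, EVERY `n ≥ 3`**: `H_{(2, 2ⁿ⁻¹ − 2, 2ⁿ⁻¹)} = H_{(1, 2ⁿ⁻¹ − 2, 2ⁿ⁻¹ + 1)}` modulo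
`2ⁿ` (the e)₁ triple `(2ᵐ, 2ⁿ⁻¹, 2ⁿ⁻¹ − 2ᵐ)` at `m = 1`, a pull-back from level `2ⁿ⁻¹`, against the a)₀ triple).  SECOND PROOF of the sibling's `fermatCMType_twoPow_furthermore_eq` (gen 36).
[cite: KoblitzRohrlich1978, Theorem 4 a), e) and "Furthermore" (p. 1186)] -/
theorem fermatCMType_twoPow_a_e₁' (hn : 3 ≤ n) :
    fermatCMType (2 ^ n) 2 (-2 + (2 : ZMod (2 ^ n)) ^ (n - 1)) ((2 : ZMod (2 ^ n)) ^ (n - 1)) =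
      fermatCMType (2 ^ n) 1 (-2 + (2 : ZMod (2 ^ n)) ^ (n - 1)) (1 + (2 : ZMod (2 ^ n)) ^ (n - 1)) := by
  haveI : Fact (Nat.Prime 2) := ⟨Nat.prime_two⟩
  have hn0 : n ≠ 0 := by omega
  haveI : Fact (1 < 2 ^ n) := ⟨Nat.one_lt_pow hn0 (by norm_num)⟩
  set H : ZMod (2 ^ n) := (2 : ZMod (2 ^ n)) ^ (n - 1) with hH
  set H' : ZMod (2 ^ n) := (2 : ZMod (2 ^ n)) ^ (n - 2) with hH'
  have hH0 : H ≠ 0 := pow_natCast_ne_zero_of_lt (p := 2) (by omega)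
  have h2H : (2 : ZMod (2 ^ n)) * H = 0 := by
    rw [hH, ← pow_succ', show n - 1 + 1 = n by omega]
    have h := ZMod.natCast_self (2 ^ n)
    push_cast at h
    exact h
  have hnegH : -H = H := by linear_combination -h2H
  have h2H' : (2 : ZMod (2 ^ n)) * H' = H := by rw [hH', hH, ← pow_succ', show n - 2 + 1 = n - 1 by omega]
  have h20 : (2 : ZMod (2 ^ n)) ≠ 0 := by
    have := pow_natCast_ne_zero_of_lt (p := 2) (n := n) (j := 1) (by omega)
    rwa [pow_one] at this
  have hc2 : ZMod.castHom (dvd_pow_self 2 hn0) (ZMod 2) (2 : ZMod (2 ^ n)) = 0 := by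
    rw [show (2 : ZMod (2 ^ n)) = ((2 : ℕ) : ZMod (2 ^ n)) by norm_num, map_natCast, ZMod.natCast_self]
  have hcH : ZMod.castHom (dvd_pow_self 2 hn0) (ZMod 2) H = 0 := by rw [hH, map_pow, hc2, zero_pow (by omega)]
  have hcH' : ZMod.castHom (dvd_pow_self 2 hn0) (ZMod 2) H' = 0 := by rw [hH', map_pow, hc2, zero_pow (by omega)]
  have huH1 : IsUnit (1 + H) :=
    isUnit_of_castHom_two_ne_zero hn0 (by rw [map_add, map_one, hcH, add_zero]; exact one_ne_zero)
  have huH'1 : IsUnit (-1 + H') :=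
    isUnit_of_castHom_two_ne_zero hn0 (by rw [map_add, map_neg, map_one, hcH', add_zero]; exact neg_ne_zero.2 one_ne_zero)
  have f2 : (2 : ZMod (2 ^ n)).val.factorization 2 = 1 := by
    have h := factorization_val_pow_mul (p := 2) (n := n) (k := 1) (by omega) isUnit_one
    rwa [Nat.cast_ofNat, pow_one, mul_one] at h
  have fH : H.val.factorization 2 = n - 1 := by
    have h := factorization_val_pow_mul (p := 2) (n := n) (k := n - 1) (by omega) isUnit_one
    rwa [mul_one, Nat.cast_ofNat] at h
  have fHm2 : (-2 + H).val.factorization 2 = 1 := by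
    have h := factorization_val_pow_mul (p := 2) (n := n) (k := 1) (by omega) huH'1
    rwa [Nat.cast_ofNat, pow_one, show (2 : ZMod (2 ^ n)) * (-1 + H') = -2 + H by linear_combination h2H'] at h
  have P1 : ∀ y : ZMod (2 ^ n), ((2 : ℕ) : ZMod (2 ^ n)) ^ ((1 : ZMod (2 ^ n)).val.factorization 2) * y = 1 ↔ y = 1 :=
    fun y => pow_factorization_mul_eq_iff_of_isUnit hn0 isUnit_one y
  have PH1 : ∀ y : ZMod (2 ^ n), ((2 : ℕ) : ZMod (2 ^ n)) ^ ((1 + H).val.factorization 2) * y = 1 + H ↔ y = 1 + H :=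
    fun y => pow_factorization_mul_eq_iff_of_isUnit hn0 huH1 y
  have P2 : ∀ y : ZMod (2 ^ n), ((2 : ℕ) : ZMod (2 ^ n)) ^ ((2 : ZMod (2 ^ n)).val.factorization 2) * y = 2 ↔ 2 * y = 2 * 1 := by
    intro y; rw [f2, Nat.cast_ofNat, pow_one, mul_one]
  have PHm2 : ∀ y : ZMod (2 ^ n), ((2 : ℕ) : ZMod (2 ^ n)) ^ ((-2 + H).val.factorization 2) * y = -2 + H ↔
      2 * y = 2 * (-1 + H') := by
    intro y
    rw [fHm2, Nat.cast_ofNat, pow_one, show (-2 + H : ZMod (2 ^ n)) = 2 * (-1 + H') by linear_combination -h2H']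
  have P4 : ∀ {y : ZMod (2 ^ n)}, IsUnit y → (((2 : ℕ) : ZMod (2 ^ n)) ^ (H.val.factorization 2) * y = H ↔ True) := by
    intro y hy
    rw [fH, Nat.cast_ofNat, iff_true]
    exact pow_pred_mul_eq_of_isUnit_twoPow hn0 hy
  have hHm20 : (-2 + H : ZMod (2 ^ n)) ≠ 0 := by
    rw [show (-2 + H : ZMod (2 ^ n)) = 2 * (-1 + H') by linear_combination -h2H']
    exact fun h => h20 (huH'1.mul_left_eq_zero.mp h)
  refine fermatCMType_eq_of_forall_countP (p := 2) hn0 one_ne_zero hHm20 huH1.ne_zero (by linear_combination h2H) h20 hHm20 hH0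
    (by linear_combination h2H) fun x hx => ?_
  have hxn : IsUnit (-x) := hx.neg
  have n1 : -x = 1 ↔ x = -1 := neg_eq_iff_eq_neg
  have n2' : -x = 1 + H ↔ x = -1 + H := by rw [neg_eq_iff_eq_neg, neg_add, hnegH]
  have m0' : 2 * -x = 2 * 1 ↔ (2 : ZMod (2 ^ n)) * x = 2 * (-1) := by
    constructor <;> intro h <;> linear_combination -h
  have m1 : 2 * -x = 2 * (-1 + H') ↔ (2 : ZMod (2 ^ n)) * x = 2 * (1 - H') := by
    constructor <;> intro h <;> linear_combination -h
  have S1 : (2 : ZMod (2 ^ n)) * x = 2 * (-1) ↔ x = -1 ∨ x = -1 + H := two_mul_eq_two_mul_iff_twoPow hn0 x (-1)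
  have S2 : (2 : ZMod (2 ^ n)) * x = 2 * 1 ↔ x = 1 ∨ x = 1 + H := two_mul_eq_two_mul_iff_twoPow hn0 x 1
  have d1 : ¬(x = -1 ∧ x = -1 + H) := fun ⟨h1, h2⟩ => hH0 (by linear_combination h1 - h2)
  have d2 : ¬(x = 1 ∧ x = 1 + H) := fun ⟨h1, h2⟩ => hH0 (by linear_combination h1 - h2)
  simp only [Multiset.insert_eq_cons, ← Multiset.cons_zero, Multiset.countP_cons, Multiset.countP_zero, P1, PH1, P2, PHm2,
    P4 hx, P4 hxn, n1, n2', m0', m1]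
  simp only [S1, S2, ite_or_eq_add d1, ite_or_eq_add d2, if_true]
  ring

/-- **The a)₀ class has three members**: `H_{(2, 2, 2ⁿ − 4)} = H_{(2, 2ⁿ⁻¹ − 2, 2ⁿ⁻¹)}` — the two e)₁ triples (pull-backs of e)₀ at level
`2ⁿ⁻¹`) — `= H_{(1, 2ⁿ⁻¹ − 2, 2ⁿ⁻¹ + 1)}` (the sibling's `fermatCMType_twoPow_e_one_eq`, gen 36). [cite: KoblitzRohrlich1978, Theorem 4 e) and "Furthermore" (p. 1186)] -/
theorem fermatCMType_twoPow_e₁ (hn : 3 ≤ n) :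
    fermatCMType (2 ^ n) 2 2 (-4) = fermatCMType (2 ^ n) 2 (-2 + (2 : ZMod (2 ^ n)) ^ (n - 1)) ((2 : ZMod (2 ^ n)) ^ (n - 1)) :=
  (fermatCMType_twoPow_a_e₁ hn).trans (fermatCMType_twoPow_a_e₁' hn).symm

end Furthermore

/-! ## §5 The printed partners in a) and c) (as legible in our copy) are unit multiples — "obvious" in the sense of p. 1185 -/

section Obvious

variable {n : ℕ}

/-- **The printed c) pair is obvious**: `(2, 2ⁿ⁻¹ − 1, 2ⁿ⁻¹ − 1) = u·(1, 1, 2ⁿ − 2)` up to order with the unit `u = 2ⁿ⁻¹ − 1`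
(`n ≥ 2`) — "c) `(2ᵐ, 2ᵐ, 2ⁿ − 2ᵐ⁺¹)` and `(2ᵐ⁺¹, 2ⁿ⁻¹ − 2ᵐ, 2ⁿ⁻¹ − 2ᵐ)`" at `m = 0` is a pair `τ′ ∼ τ` ("`L_{r,s} = L_{⟨hr⟩,⟨hs⟩}`",
§1). [cite: KoblitzRohrlich1978, Theorem 4 c) (p. 1186) and §1 (p. 1185)] -/
theorem exists_unit_multiset_eq_twoPow_c (hn : 2 ≤ n) :
    ∃ u : ZMod (2 ^ n), IsUnit u ∧
      ({2, -1 + (2 : ZMod (2 ^ n)) ^ (n - 1), -1 + (2 : ZMod (2 ^ n)) ^ (n - 1)} : Multiset (ZMod (2 ^ n))) =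
        {u * 1, u * 1, u * (-2)} := by
  haveI : Fact (Nat.Prime 2) := ⟨Nat.prime_two⟩
  have hn0 : n ≠ 0 := by omega
  set H : ZMod (2 ^ n) := (2 : ZMod (2 ^ n)) ^ (n - 1) with hH
  have h2H : (2 : ZMod (2 ^ n)) * H = 0 := by
    rw [hH, ← pow_succ', show n - 1 + 1 = n by omega]
    have h := ZMod.natCast_self (2 ^ n)
    push_cast at h
    exact h
  have hc2 : ZMod.castHom (dvd_pow_self 2 hn0) (ZMod 2) (2 : ZMod (2 ^ n)) = 0 := by
    rw [show (2 : ZMod (2 ^ n)) = ((2 : ℕ) : ZMod (2 ^ n)) by norm_num, map_natCast, ZMod.natCast_self]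
  have hcH : ZMod.castHom (dvd_pow_self 2 hn0) (ZMod 2) H = 0 := by rw [hH, map_pow, hc2, zero_pow (by omega)]
  have huH1 : IsUnit (-1 + H) :=
    isUnit_of_castHom_two_ne_zero hn0 (by rw [map_add, map_neg, map_one, hcH, add_zero]; exact neg_ne_zero.2 one_ne_zero)
  refine ⟨-1 + H, huH1, ?_⟩
  have e3 : (-1 + H) * (-2 : ZMod (2 ^ n)) = 2 := by linear_combination -h2H
  rw [mul_one, e3]
  simp only [Multiset.insert_eq_cons, ← Multiset.cons_zero]
  rw [Multiset.cons_swap (2 : ZMod (2 ^ n)) (-1 + H), Multiset.cons_swap (2 : ZMod (2 ^ n)) (-1 + H)]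

/-- **The printed a) partner is obvious**: `(2, 2ⁿ⁻² − 1, 3·2ⁿ⁻² − 1) = u·(1, 2ⁿ⁻¹ − 2, 2ⁿ⁻¹ + 1)` up to order with the unit
`u = 2ⁿ⁻² − 1` (`n ≥ 3`; `3·2ⁿ⁻² − 1` written `2ⁿ⁻² − 1 + 2ⁿ⁻¹`) — "a) `(2ᵐ, 2ⁿ⁻¹ − 2ᵐ⁺¹, 2ⁿ⁻¹ + 2ᵐ)` and
`(2ᵐ⁺¹, 2ⁿ⁻² − 2ᵐ, 3(2ⁿ⁻²) − 2ᵐ)`" at `m = 0`, as legible in our copy, is a pair `τ′ ∼ τ`.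
[cite: KoblitzRohrlich1978, Theorem 4 a) (p. 1186) and §1 (p. 1185)] -/
theorem exists_unit_multiset_eq_twoPow_a (hn : 3 ≤ n) :
    ∃ u : ZMod (2 ^ n), IsUnit u ∧
      ({2, -1 + (2 : ZMod (2 ^ n)) ^ (n - 2), -1 + (2 : ZMod (2 ^ n)) ^ (n - 2) + (2 : ZMod (2 ^ n)) ^ (n - 1)} :
          Multiset (ZMod (2 ^ n))) =
        {u * 1, u * (-2 + (2 : ZMod (2 ^ n)) ^ (n - 1)), u * (1 + (2 : ZMod (2 ^ n)) ^ (n - 1))} := by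
  haveI : Fact (Nat.Prime 2) := ⟨Nat.prime_two⟩
  have hn0 : n ≠ 0 := by omega
  set H : ZMod (2 ^ n) := (2 : ZMod (2 ^ n)) ^ (n - 1) with hH
  set H' : ZMod (2 ^ n) := (2 : ZMod (2 ^ n)) ^ (n - 2) with hH'
  have h2n : (2 : ZMod (2 ^ n)) ^ n = 0 := by
    have h := ZMod.natCast_self (2 ^ n)
    push_cast at h
    exact h
  have h2H : (2 : ZMod (2 ^ n)) * H = 0 := by rw [hH, ← pow_succ', show n - 1 + 1 = n by omega, h2n]
  have h2H' : (2 : ZMod (2 ^ n)) * H' = H := by rw [hH', hH, ← pow_succ', show n - 2 + 1 = n - 1 by omega]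
  have hHH' : H' * H = 0 := by
    rw [hH', hH, ← pow_add, show n - 2 + (n - 1) = n + (n - 3) by omega, pow_add, h2n, zero_mul]
  have hc2 : ZMod.castHom (dvd_pow_self 2 hn0) (ZMod 2) (2 : ZMod (2 ^ n)) = 0 := by
    rw [show (2 : ZMod (2 ^ n)) = ((2 : ℕ) : ZMod (2 ^ n)) by norm_num, map_natCast, ZMod.natCast_self]
  have hcH' : ZMod.castHom (dvd_pow_self 2 hn0) (ZMod 2) H' = 0 := by rw [hH', map_pow, hc2, zero_pow (by omega)]
  have huH'1 : IsUnit (-1 + H') :=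
    isUnit_of_castHom_two_ne_zero hn0 (by rw [map_add, map_neg, map_one, hcH', add_zero]; exact neg_ne_zero.2 one_ne_zero)
  refine ⟨-1 + H', huH'1, ?_⟩
  have e2 : (-1 + H') * (-2 + H) = (2 : ZMod (2 ^ n)) := by linear_combination -h2H' - h2H + hHH'
  have e3 : (-1 + H') * (1 + H) = -1 + H' + H := by linear_combination -h2H + hHH'
  rw [mul_one, e2, e3]
  simp only [Multiset.insert_eq_cons]
  rw [Multiset.cons_swap (2 : ZMod (2 ^ n)) (-1 + H')]

end Obvious

end CyclotomicFermatCMType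

end Literature.AlgebraicGeometry.ComplexMultiplication
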